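import Literature.Analysis.TotalPositivity.PolyaFrequencyFunctionsProofs
import Mathlib.MeasureTheory.Integral.Pi
import Mathlib.Data.Fin.Tuple.Sort
import HarnessLib

/-!
# Variation diminishing property of strictly totally positive translation kernels
(Schoenberg 1951, necessity half, step N2c)

Trunk `Literature/Analysis/TotalPositivity`, eleventh proofs file accompanying
`PolyaFrequencyFunctions.lean` (the named fact `schoenberg1951_pf_laplace`).  The variation
diminishing property of totally positive kernels [Schoenberg 1930 for matrices; Schoenberg
1950/1951 for the convolution transform `g = K ⋆ f`], in the following form sufficient for the
necessity half of Schoenberg's theorem (where it is applied to real polynomials `f`):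

> Let `K ≥ 0` have STRICTLY positive translation determinants (as produced by
> `PolyaFrequencySmoothing.lean`), let `f` be measurable with `t ↦ K(c − t) f(t)` integrable for
> every `c`, and suppose `ℝ` minus finitely many points `r₀ < ⋯ < r_{m−1}` splits into the
> `m + 1` complementary open intervals `B_0 < B_1 < ⋯ < B_m` on each of which `f` has a constant
> non-zero sign `ε_j`.  Then `g(x) = ∫ K(x − t) f(t) dt` does NOT alternate strictly in sign at
> any `m + 2` increasing points (`no_alternation_of_strict_tp`).

Proof (the classical determinant argument, [Karlin1968, Ch. 5 §1; Pinkus, Thm. 3.2]): with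
`u_j(x) = ∫_{B_j} K(x − t)|f(t)| dt` one has `g = Σ_j ε_j u_j`; if `g(z_0), …, g(z_{m+1})`
alternated strictly, the `(m+2) × (m+2)` matrix `[u_j(z_i) | g(z_i)]` would be singular (last
column a combination of the others), while its Laplace expansion along the last column is a sum
of terms of one strict sign, because every minor `det ‖u_j(z_i)‖_{i ≠ i₀}` equals
`∫_{B_0 × ⋯ × B_m} det ‖K(z_i − t_j)‖ ∏_j |f(t_j)| dt > 0` (multilinearity/Fubini; on the box the
`t_j` are automatically increasing, so the integrand is positive by strict total positivity).

The `j`-th block is written throughout as the predicate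
`∀ k : Fin m, (k < j → r k < t) ∧ (j ≤ k → t < r k)`.

## References

* I. J. Schoenberg, *Über variationsvermindernde lineare Transformationen*, Math. Z. 32 (1930)
  321–328; *On Pólya frequency functions. I*, J. Analyse Math. 1 (1951) 331–374, §§7–8.
  [Schoenberg1951]
* S. Karlin, *Total Positivity* I (1968), Ch. 5 §1 (variation diminishing), Ch. 7 §2.
  [Karlin1968]
* A. Pinkus, *Totally Positive Matrices*, Cambridge 2010, Thm. 3.2. [folklore]
-/

noncomputable section

open MeasureTheory Set Filter Finset
open scoped Topology

namespace Literature.Analysis.TotalPositivity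

/-! ### The complementary intervals of finitely many points -/

/-- On the `j`-th block the counting function `#{i | r_i < t}` equals `j`. [folklore] -/
theorem card_filter_lt_eq_of_block {m : ℕ} {r : Fin m → ℝ} {j : ℕ} (hj : j ≤ m) {t : ℝ}
    (ht : ∀ k : Fin m, ((k : ℕ) < j → r k < t) ∧ (j ≤ (k : ℕ) → t < r k)) :
    (Finset.univ.filter fun i : Fin m => r i < t).card = j := by
  have hset : (Finset.univ.filter fun i : Fin m => r i < t) =
      Finset.univ.filter fun i : Fin m => (i : ℕ) < j := by
    ext i
    simp only [Finset.mem_filter, Finset.mem_univ, true_and]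
    constructor
    · intro hi
      by_contra hcon
      push Not at hcon
      have := (ht i).2 hcon
      linarith
    · intro hi
      exact (ht i).1 hi
  rw [hset, Fin.card_filter_val_lt, min_eq_right hj]

/-- Off the points `r_i`, the point `t` lies in the block of index `#{i | r_i < t}`. [folklore] -/
theorem block_card_filter_lt {m : ℕ} {r : Fin m → ℝ} (hr : StrictMono r) {t : ℝ}
    (ht : t ∉ Set.range r) :
    ∀ k : Fin m, ((k : ℕ) < (Finset.univ.filter fun i : Fin m => r i < t).card → r k < t) ∧
      ((Finset.univ.filter fun i : Fin m => r i < t).card ≤ (k : ℕ) → t < r k) := by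
  classical
  intro k
  have hk := Tuple.lt_card_lt_iff_apply_lt_of_monotone (j := k) (a := t) hr.monotone
  constructor
  · intro h
    exact hk.1 h
  · intro h
    have hnot : ¬ r k < t := fun h' => absurd (hk.2 h') (not_lt.2 h)
    have hne : r k ≠ t := fun h' => ht ⟨k, h'⟩
    exact lt_of_le_of_ne (not_lt.1 hnot) (Ne.symm hne)

/-- The blocks are ordered: `t ∈ B_j`, `t' ∈ B_{j'}`, `j < j' ≤ m` imply `t < t'`. [folklore] -/
theorem lt_of_block_lt_block {m : ℕ} {r : Fin m → ℝ} {j j' : ℕ} (hjj' : j < j') (hj' : j' ≤ m)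
    {t t' : ℝ} (ht : ∀ k : Fin m, ((k : ℕ) < j → r k < t) ∧ (j ≤ (k : ℕ) → t < r k))
    (ht' : ∀ k : Fin m, ((k : ℕ) < j' → r k < t') ∧ (j' ≤ (k : ℕ) → t' < r k)) : t < t' := by
  have hjm : j < m := lt_of_lt_of_le hjj' hj'
  have h1 := (ht ⟨j, hjm⟩).2 le_rfl
  have h2 := (ht' ⟨j, hjm⟩).1 hjj'
  exact h1.trans h2

/-- The blocks are open. [folklore] -/
theorem isOpen_block {m : ℕ} (r : Fin m → ℝ) (j : ℕ) :
    IsOpen {t : ℝ | ∀ k : Fin m, ((k : ℕ) < j → r k < t) ∧ (j ≤ (k : ℕ) → t < r k)} := by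
  have : {t : ℝ | ∀ k : Fin m, ((k : ℕ) < j → r k < t) ∧ (j ≤ (k : ℕ) → t < r k)} =
      ⋂ k : Fin m, ({t : ℝ | (k : ℕ) < j → r k < t} ∩ {t : ℝ | j ≤ (k : ℕ) → t < r k}) := by
    ext t
    simp only [Set.mem_setOf_eq, Set.mem_iInter, Set.mem_inter_iff]
  rw [this]
  refine isOpen_iInter_of_finite fun k => IsOpen.inter ?_ ?_
  · by_cases h : (k : ℕ) < j
    · have h1 : {t : ℝ | (k : ℕ) < j → r k < t} = Set.Ioi (r k) := by
        ext t
        simp [h]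
      rw [h1]
      exact isOpen_Ioi
    · have h1 : {t : ℝ | (k : ℕ) < j → r k < t} = Set.univ := by
        ext t
        simp [h]
      rw [h1]
      exact isOpen_univ
  · by_cases h : j ≤ (k : ℕ)
    · have h1 : {t : ℝ | j ≤ (k : ℕ) → t < r k} = Set.Iio (r k) := by
        ext t
        simp [h]
      rw [h1]
      exact isOpen_Iio
    · have h1 : {t : ℝ | j ≤ (k : ℕ) → t < r k} = Set.univ := by
        ext t
        simp [h]
      rw [h1]
      exact isOpen_univ

/-- The blocks are non-empty for strictly increasing points. [folklore] -/
theorem block_nonempty {m : ℕ} {r : Fin m → ℝ} (hr : StrictMono r) {j : ℕ} (hj : j ≤ m) :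
    ∃ t : ℝ, ∀ k : Fin m, ((k : ℕ) < j → r k < t) ∧ (j ≤ (k : ℕ) → t < r k) := by
  rcases Nat.eq_zero_or_pos m with hm | hm
  · subst hm
    exact ⟨0, fun k => Fin.elim0 k⟩
  by_cases hj0 : j = 0
  · subst hj0
    refine ⟨r ⟨0, hm⟩ - 1, fun k => ⟨fun h => absurd h (Nat.not_lt_zero _), fun _ => ?_⟩⟩
    have : r ⟨0, hm⟩ ≤ r k := hr.monotone (by
      rw [Fin.le_def]
      exact Nat.zero_le _)
    linarith
  by_cases hjm : j = m
  · subst hjm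
    refine ⟨r ⟨j - 1, by omega⟩ + 1, fun k => ⟨fun _ => ?_, fun h => absurd h (by omega)⟩⟩
    have : r k ≤ r ⟨j - 1, by omega⟩ := hr.monotone (by
      rw [Fin.le_def]
      have := k.2
      show (k : ℕ) ≤ j - 1
      omega)
    linarith
  · have hjm' : j < m := lt_of_le_of_ne hj hjm
    have hj1 : 0 < j := Nat.pos_of_ne_zero hj0
    have h2 : r ⟨j - 1, by omega⟩ < r ⟨j, hjm'⟩ := hr (Fin.mk_lt_mk.2 (by omega))
    refine ⟨(r ⟨j - 1, by omega⟩ + r ⟨j, hjm'⟩) / 2, fun k => ⟨fun h => ?_, fun h => ?_⟩⟩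
    · have h1 : r k ≤ r ⟨j - 1, by omega⟩ := hr.monotone (by
        rw [Fin.le_def]
        show (k : ℕ) ≤ j - 1
        omega)
      linarith
    · have h1 : r ⟨j, hjm'⟩ ≤ r k := hr.monotone (by
        rw [Fin.le_def]
        exact h)
      linarith

/-! ### The variation diminishing property -/

/-- **Variation diminishing property of strictly totally positive translation kernels**
(Schoenberg): if `K ≥ 0` has strictly positive translation determinants, `t ↦ K(c − t)f(t)` is
integrable for every `c`, and `f` has constant non-zero sign `ε_j` on each of the `m + 1`
complementary open intervals of `r₀ < ⋯ < r_{m−1}`, then `g(x) = ∫ K(x − t) f(t) dt` cannot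
alternate strictly in sign at `m + 2` strictly increasing points.
[cite: Schoenberg1951, §§7–8] [cite: Karlin1968, Ch. 5 §1] -/
theorem no_alternation_of_strict_tp {K f : ℝ → ℝ} (hK0 : ∀ u, 0 ≤ K u)
    (hSTP : ∀ (n : ℕ) (x y : Fin n → ℝ), StrictMono x → StrictMono y → 0 < translationMinor K x y)
    (hint : ∀ c : ℝ, Integrable fun t => K (c - t) * f t)
    {m : ℕ} {r : Fin m → ℝ} (hr : StrictMono r) {ε : Fin (m + 1) → ℝ}
    (hε : ∀ j, ε j = 1 ∨ ε j = -1)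
    (hsign : ∀ (j : Fin (m + 1)) (t : ℝ),
      (∀ k : Fin m, ((k : ℕ) < (j : ℕ) → r k < t) ∧ ((j : ℕ) ≤ (k : ℕ) → t < r k)) → 0 < ε j * f t)
    {z : Fin (m + 2) → ℝ} (hz : StrictMono z) :
    ¬ ∀ i : Fin (m + 1), (∫ t, K (z i.castSucc - t) * f t) * (∫ t, K (z i.succ - t) * f t) < 0 := by
  classical
  intro halt
  -- the blocks as sets
  set B : Fin (m + 1) → Set ℝ := fun j =>
    {t : ℝ | ∀ k : Fin m, ((k : ℕ) < (j : ℕ) → r k < t) ∧ ((j : ℕ) ≤ (k : ℕ) → t < r k)} with hB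
  have hBmeas : ∀ j, MeasurableSet (B j) := fun j => (isOpen_block r j).measurableSet
  -- `f = ε_j |f|` and `f ≠ 0` on `B_j`
  have hfB : ∀ j, ∀ t ∈ B j, f t = ε j * |f t| := by
    intro j t ht
    have hs := hsign j t ht
    rcases hε j with h1 | h1
    · rw [h1, one_mul] at hs ⊢
      exact (abs_of_pos hs).symm
    · rw [h1] at hs ⊢
      have : f t < 0 := by linarith
      rw [abs_of_neg this]
      ring
  have hfne : ∀ j, ∀ t ∈ B j, f t ≠ 0 := by
    intro j t ht h0
    have hs := hsign j t ht
    rw [h0, mul_zero] at hs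
    exact lt_irrefl 0 hs
  -- partition of `ℝ` minus the finite set `range r`
  have hpart : ∀ t : ℝ, t ∉ Set.range r →
      ∑ j : Fin (m + 1), (B j).indicator (fun _ => (1 : ℝ)) t = 1 := by
    intro t ht
    set J := (Finset.univ.filter fun i : Fin m => r i < t).card with hJ
    have hJm : J < m + 1 := Nat.lt_succ_of_le ((Finset.card_filter_le _ _).trans (by simp))
    have hmem : ∀ j : Fin (m + 1), t ∈ B j ↔ (j : ℕ) = J := by
      intro j
      constructor
      · intro hj
        exact (card_filter_lt_eq_of_block (Nat.le_of_lt_succ j.2) hj).symm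
      · intro hj
        show ∀ k : Fin m, ((k : ℕ) < (j : ℕ) → r k < t) ∧ ((j : ℕ) ≤ (k : ℕ) → t < r k)
        rw [hj]
        exact block_card_filter_lt hr ht
    have hind : ∀ j : Fin (m + 1), (B j).indicator (fun _ => (1 : ℝ)) t =
        if j = ⟨J, hJm⟩ then 1 else 0 := by
      intro j
      by_cases hj : j = ⟨J, hJm⟩
      · rw [if_pos hj, Set.indicator_of_mem ((hmem j).2 (by rw [hj]))]
      · rw [if_neg hj, Set.indicator_of_notMem]
        intro hmemj
        exact hj (Fin.ext ((hmem j).1 hmemj))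
    simp only [hind, Finset.sum_ite_eq', Finset.mem_univ, if_true]
  have hnull : (Set.range r)ᶜ ∈ ae (volume : Measure ℝ) := by
    rw [mem_ae_iff, compl_compl]
    exact (Set.finite_range r).measure_zero volume
  -- decomposition of the integrals of `h f`, `h ≥ 0`
  have hdecomp : ∀ h : ℝ → ℝ, (∀ t, 0 ≤ h t) → Integrable (fun t => h t * f t) →
      ∫ t, h t * f t = ∑ j, ε j * ∫ t, (B j).indicator (fun t => h t * |f t|) t := by
    intro h h0 hh
    have hae : (fun t => h t * f t) =ᵐ[volume]
        fun t => ∑ j, ε j * (B j).indicator (fun t => h t * |f t|) t := by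
      filter_upwards [hnull] with t ht
      have hp := hpart t ht
      calc h t * f t = (∑ j : Fin (m + 1), (B j).indicator (fun _ => (1 : ℝ)) t) * (h t * f t) := by
            rw [hp, one_mul]
        _ = ∑ j, (B j).indicator (fun _ => (1 : ℝ)) t * (h t * f t) := Finset.sum_mul _ _ _
        _ = ∑ j, ε j * (B j).indicator (fun t => h t * |f t|) t := by
            refine Finset.sum_congr rfl fun j _ => ?_
            by_cases hj : t ∈ B j
            · rw [Set.indicator_of_mem hj, Set.indicator_of_mem hj]
              have hft := hfB j t hj
              rw [show h t * f t = h t * (ε j * |f t|) by rw [← hft]]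
              ring
            · rw [Set.indicator_of_notMem hj, Set.indicator_of_notMem hj]
              ring
    have hI : ∀ j, Integrable fun t => (B j).indicator (fun t => h t * |f t|) t := fun j =>
      (hh.norm.congr (Eventually.of_forall fun t => by
        simp only [norm_mul, Real.norm_eq_abs, abs_of_nonneg (h0 t)])).indicator (hBmeas j)
    rw [integral_congr_ae hae, integral_finsetSum _ (fun j _ => (hI j).const_mul _)]
    simp only [integral_const_mul]
  -- the functions `u_j` and `g`
  set u : Fin (m + 1) → ℝ → ℝ := fun j x => ∫ t, (B j).indicator (fun t => K (x - t) * |f t|) t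
    with hu
  set g : ℝ → ℝ := fun x => ∫ t, K (x - t) * f t with hg
  have hgu : ∀ x, g x = ∑ j, ε j * u j x := fun x =>
    hdecomp (fun t => K (x - t)) (fun t => hK0 _) (hint x)
  -- strict alternation gives a constant sign to `(-1)^i g(z_i)`
  have halt' : ∀ i : Fin (m + 1), g (z i.castSucc) * g (z i.succ) < 0 := halt
  set s : ℝ := if 0 < g (z 0) then 1 else -1 with hs
  have hspos : ∀ i : ℕ, (hi : i < m + 2) → 0 < s * ((-1) ^ i * g (z ⟨i, hi⟩)) := by
    intro i
    induction i with
    | zero =>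
      intro hi
      have hne : g (z 0) ≠ 0 := by
        intro h0
        have := halt' 0
        rw [Fin.castSucc_zero, h0, zero_mul] at this
        exact lt_irrefl 0 this
      simp only [pow_zero, one_mul]
      by_cases hpos : 0 < g (z 0)
      · rw [hs, if_pos hpos, one_mul]
        exact hpos
      · rw [hs, if_neg hpos]
        have : g (z 0) < 0 := lt_of_le_of_ne (not_lt.1 hpos) hne
        show 0 < -1 * g (z ⟨0, hi⟩)
        have h0 : (⟨0, hi⟩ : Fin (m + 2)) = 0 := rfl
        rw [h0]
        linarith
    | succ i ih =>
      intro hi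
      have hi' : i < m + 1 := Nat.lt_of_succ_lt_succ hi
      have h1 := ih (Nat.lt_of_succ_lt hi)
      have h2 := halt' ⟨i, hi'⟩
      have hcs : (⟨i, hi'⟩ : Fin (m + 1)).castSucc = ⟨i, Nat.lt_of_succ_lt hi⟩ := rfl
      have hsc : (⟨i, hi'⟩ : Fin (m + 1)).succ = ⟨i + 1, hi⟩ := rfl
      rw [hcs, hsc] at h2
      have h3 : 0 < s * ((-1) ^ i * g (z ⟨i, Nat.lt_of_succ_lt hi⟩)) *
          -(g (z ⟨i, Nat.lt_of_succ_lt hi⟩) * g (z ⟨i + 1, hi⟩)) := mul_pos h1 (by linarith)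
      have h4 : 0 < g (z ⟨i, Nat.lt_of_succ_lt hi⟩) ^ 2 := by
        have : g (z ⟨i, Nat.lt_of_succ_lt hi⟩) ≠ 0 := fun h0 => by
          rw [h0, zero_mul] at h2
          exact lt_irrefl 0 h2
        positivity
      have h5 : s * ((-1) ^ (i + 1) * g (z ⟨i + 1, hi⟩)) * g (z ⟨i, Nat.lt_of_succ_lt hi⟩) ^ 2 =
          s * ((-1) ^ i * g (z ⟨i, Nat.lt_of_succ_lt hi⟩)) *
            -(g (z ⟨i, Nat.lt_of_succ_lt hi⟩) * g (z ⟨i + 1, hi⟩)) := by ring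
      have h6 : 0 < s * ((-1) ^ (i + 1) * g (z ⟨i + 1, hi⟩)) * g (z ⟨i, Nat.lt_of_succ_lt hi⟩) ^ 2 := by
        rw [h5]
        exact h3
      exact pos_of_mul_pos_left h6 h4.le
  -- the matrix `W = [u_j(z_i) | g(z_i)]`
  set W : Matrix (Fin (m + 2)) (Fin (m + 2)) ℝ := Matrix.of fun i l =>
    Fin.snoc (α := fun _ => ℝ) (fun j : Fin (m + 1) => u j (z i)) (g (z i)) l with hW
  have hWlast : ∀ i, W i (Fin.last (m + 1)) = g (z i) := by
    intro i
    simp [hW]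
  have hWcast : ∀ i j, W i (Fin.castSucc j) = u j (z i) := by
    intro i j
    simp [hW]
  -- `det W = 0`
  have hdet0 : W.det = 0 := by
    set c : Fin (m + 2) → ℝ := Fin.snoc (α := fun _ => ℝ) ε 0 with hc
    have hcol : (fun k => ∑ i, c i • W k i) = fun k => W k (Fin.last (m + 1)) := by
      funext k
      rw [Fin.sum_univ_castSucc, hWlast, hgu]
      simp [hc, hWcast, smul_eq_mul]
    have h := Matrix.det_updateCol_sum W (Fin.last (m + 1)) c
    rw [hcol, Matrix.updateCol_eq_self] at h
    have hclast : c (Fin.last (m + 1)) = 0 := by simp [hc]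
    rw [hclast, zero_smul] at h
    exact h
  -- Laplace expansion along the last column
  have hlap := Matrix.det_succ_column W (Fin.last (m + 1))
  rw [hdet0] at hlap
  have hsubm : ∀ i : Fin (m + 2), W.submatrix i.succAbove (Fin.last (m + 1)).succAbove =
      Matrix.of fun a b : Fin (m + 1) => u b (z (i.succAbove a)) := by
    intro i
    ext a b
    simp [Matrix.submatrix_apply, Fin.succAbove_last, hWcast]
  simp only [hsubm, hWlast, Fin.val_last] at hlap
  -- positivity of the minors
  have hminor : ∀ i : Fin (m + 2), 0 < (Matrix.of fun a b : Fin (m + 1) => u b (z (i.succAbove a))).det := by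
    intro i
    set zz : Fin (m + 1) → ℝ := fun a => z (i.succAbove a) with hzz
    have hzzm : StrictMono zz := hz.comp (Fin.strictMono_succAbove i)
    have hIb : ∀ (b : Fin (m + 1)) (c : ℝ),
        Integrable fun t => (B b).indicator (fun t => K (c - t) * |f t|) t := fun b c =>
      ((hint c).norm.congr (Eventually.of_forall fun t => by
        simp only [norm_mul, Real.norm_eq_abs, abs_of_nonneg (hK0 _)])).indicator (hBmeas b)
    set F : Equiv.Perm (Fin (m + 1)) → (Fin (m + 1) → ℝ) → ℝ := fun σ T =>
      ∏ b, (B b).indicator (fun t => K (zz (σ b) - t) * |f t|) (T b) with hF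
    have hFi : ∀ σ, Integrable (F σ) := fun σ =>
      Integrable.fintype_prod (f := fun b t => (B b).indicator (fun t => K (zz (σ b) - t) * |f t|) t)
        fun b => hIb b _
    -- the determinant as an integral over `ℝ^{m+1}`
    have hdet : (Matrix.of fun a b : Fin (m + 1) => u b (zz a)).det =
        ∫ T, ∑ σ : Equiv.Perm (Fin (m + 1)), ((Equiv.Perm.sign σ : ℤ) : ℝ) * F σ T := by
      rw [Matrix.det_apply']
      simp only [Matrix.of_apply, hu]
      have hprod : ∀ σ : Equiv.Perm (Fin (m + 1)),
          (∏ b, ∫ t, (B b).indicator (fun t => K (zz (σ b) - t) * |f t|) t) = ∫ T, F σ T := fun σ =>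
        (integral_fintype_prod_volume_eq_prod
          (fun b t => (B b).indicator (fun t => K (zz (σ b) - t) * |f t|) t)).symm
      simp only [hprod, ← integral_const_mul]
      rw [integral_finsetSum _ fun σ _ => (hFi σ).const_mul _]
    -- pointwise identity of the integrand
    set box : Set (Fin (m + 1) → ℝ) := Set.pi Set.univ B with hbox
    have hptw : (fun T => ∑ σ : Equiv.Perm (Fin (m + 1)), ((Equiv.Perm.sign σ : ℤ) : ℝ) * F σ T) =
        box.indicator fun T => (∏ b, |f (T b)|) * translationMinor K zz T := by
      funext T
      by_cases hT : T ∈ box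
      · rw [Set.indicator_of_mem hT]
        have hTb : ∀ b, T b ∈ B b := fun b => hT b (Set.mem_univ b)
        unfold translationMinor
        rw [Matrix.det_apply', Finset.mul_sum]
        refine Finset.sum_congr rfl fun σ _ => ?_
        rw [hF]
        simp only [Set.indicator_of_mem (hTb _), Matrix.of_apply, Finset.prod_mul_distrib]
        have hre : (∏ x, |f (T x)|) = ∏ x, |f (T x)| := rfl
        ring
      · rw [Set.indicator_of_notMem hT]
        have : ∃ b₀, T b₀ ∉ B b₀ := by
          simpa [hbox, Set.mem_univ_pi] using hT
        obtain ⟨b₀, hb₀⟩ := this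
        refine Finset.sum_eq_zero fun σ _ => ?_
        have hz0 : F σ T = 0 := by
          rw [hF]
          exact Finset.prod_eq_zero (Finset.mem_univ b₀) (Set.indicator_of_notMem hb₀ _)
        rw [hz0, mul_zero]
    -- integrability, non-negativity and support of the integrand
    have hΦi : Integrable (box.indicator fun T => (∏ b, |f (T b)|) * translationMinor K zz T) := by
      rw [← hptw]
      exact integrable_finsetSum _ fun σ _ => (hFi σ).const_mul _
    have hTmono : ∀ T ∈ box, StrictMono T := by
      intro T hT a b hab
      have hTa : T a ∈ B a := hT a (Set.mem_univ a)
      have hTb : T b ∈ B b := hT b (Set.mem_univ b)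
      exact lt_of_block_lt_block (Fin.lt_def.1 hab) (Nat.le_of_lt_succ b.2) hTa hTb
    have hΦpos : ∀ T ∈ box, 0 < (∏ b, |f (T b)|) * translationMinor K zz T := by
      intro T hT
      refine mul_pos (Finset.prod_pos fun b _ => abs_pos.2 (hfne b _ (hT b (Set.mem_univ b)))) ?_
      exact hSTP _ zz T hzzm (hTmono T hT)
    have hΦ0 : ∀ T, 0 ≤ box.indicator (fun T => (∏ b, |f (T b)|) * translationMinor K zz T) T := by
      intro T
      by_cases hT : T ∈ box
      · rw [Set.indicator_of_mem hT]
        exact (hΦpos T hT).le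
      · rw [Set.indicator_of_notMem hT]
    rw [hdet, hptw, integral_pos_iff_support_of_nonneg hΦ0 hΦi]
    have hopen : IsOpen box := by
      rw [hbox]
      exact isOpen_set_pi Set.finite_univ fun j _ => isOpen_block r j
    have hne : box.Nonempty := by
      rw [hbox]
      exact Set.univ_pi_nonempty_iff.2 fun j => block_nonempty hr (Nat.le_of_lt_succ j.2)
    have hsub : box ⊆ Function.support
        (box.indicator fun T => (∏ b, |f (T b)|) * translationMinor K zz T) := by
      intro T hT
      rw [Function.mem_support, Set.indicator_of_mem hT]
      exact (hΦpos T hT).ne'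
    exact (hopen.measure_pos volume hne).trans_le (measure_mono hsub)
  -- the Laplace expansion is a sum of terms of one strict sign: contradiction
  have hterm : ∀ i : Fin (m + 2), 0 < s * (-1) ^ (m + 1) *
      ((-1) ^ ((i : ℕ) + (m + 1)) * g (z i) *
        (Matrix.of fun a b : Fin (m + 1) => u b (z (i.succAbove a))).det) := by
    intro i
    have h1 := hspos i i.2
    have h2 := hminor i
    have heq : s * (-1) ^ (m + 1) * ((-1) ^ ((i : ℕ) + (m + 1)) * g (z i) *
        (Matrix.of fun a b : Fin (m + 1) => u b (z (i.succAbove a))).det) =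
        (s * ((-1) ^ (i : ℕ) * g (z ⟨i, i.2⟩))) *
          (Matrix.of fun a b : Fin (m + 1) => u b (z (i.succAbove a))).det := by
      have hi : (⟨i, i.2⟩ : Fin (m + 2)) = i := rfl
      rw [hi, pow_add]
      have hsq : ((-1 : ℝ) ^ (m + 1)) * ((-1 : ℝ) ^ (m + 1)) = 1 := by
        rw [← pow_add, ← two_mul, pow_mul]
        norm_num
      linear_combination (s * (-1) ^ (i : ℕ) * g (z i) *
        (Matrix.of fun a b : Fin (m + 1) => u b (z (i.succAbove a))).det) * hsq
    rw [heq]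
    exact mul_pos h1 h2
  have hsum : 0 < ∑ i : Fin (m + 2), s * (-1) ^ (m + 1) *
      ((-1) ^ ((i : ℕ) + (m + 1)) * g (z i) *
        (Matrix.of fun a b : Fin (m + 1) => u b (z (i.succAbove a))).det) :=
    Finset.sum_pos (fun i _ => hterm i) Finset.univ_nonempty
  rw [← Finset.mul_sum, ← hlap, mul_zero] at hsum
  exact lt_irrefl 0 hsum

end Literature.Analysis.TotalPositivity

end
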